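import Literature.NumberTheory.GaloisRepresentations.GaloisCohomologyUnitsInflationCocycle
import Literature.NumberTheory.GaloisRepresentations.BrauerGroupCocycles
import Literature.NumberTheory.GaloisCohomology.CyclicClassLocalNorm
import Literature.AnabelianGeometry.AbsoluteAnabelian.LocalResidueMapRestrictionIndex
import HarnessLib

/-!
# Restriction of the canonical local fundamental class: `inv_E ∘ Res_{E/K} = [E:K] · inv_K` on Brauer groups
# and `Res u_{L/K} = u_{L/E}` (Serre, *Local Fields* XIII §3 Prop. 7, XI §3; Neukirch, *Bonn Lectures* II (1.6) b))

Topic `NumberTheory/GaloisRepresentations` (local class field theory); namespace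
`Literature.NumberTheory.GaloisRepresentations.UnitsLayer` (door-c6 g10's `LocalCanonicalFundamentalClass*`:
`layerInv K L : H²(Gal(L/K), Lˣ) →+ ℚ/ℤ`, `fundamentalClass K L`).  Definitions with bodies (the restriction map of
the units layer to an intermediate base) and theorems; no named fact, no notation, no new instance — one LOCAL instance
attribute (`-- WORDING-FIX (2026-08-28, door-c6 g13; referee N-g52-3): the header now declares this local instance attribute.
attribute [local instance] absoluteGaloisGroup_compactSpace`, the tree's theorem, needed to form continuous
`2`-cocycle classes; no override).

For a tower `K ⊆ E ⊆ L` of finite extensions of a characteristic-`0` non-archimedean local field `K` with `L/K`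
Galois, door-c6 g10 left open (FINDING-door-c6-g10 §5 (v)) the RESTRICTION formula relating the canonical classes
read through the two algebraic closures `K̄` and `Ē`.  With door-c6 g12's compatible-pair machinery
(`ContinuousH2CompatiblePairs`, `GaloisCohomologyUnitsInflationCocycle`) it is now a dictionary statement:

* §1 **`brauerInvariantEquiv_map_res`**: `inv_E (H²(res_{E/K}, ι) z) = [E:K] · inv_K z` for every `z ∈ Br(K) =
  H²(Γ_K, K̄ˣ)` and every standard units morphism `ι : K̄ˣ → Ēˣ` over `res : Γ_E → Γ_K` (Serre XIII §3 Prop. 7;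
  from the tree's level-`n` statement `invLevel_resMu` through Kummer, `cohomologyMap_kummerι_resMu`).
* §2 `unitsResHom K E L`, **`unitsRes K E L n : Hⁿ(Gal(L/K), Lˣ) ⟶ Hⁿ(Gal(L/E), Lˣ)`** (Mathlib `groupCohomology.map`
  along `AlgEquiv.restrictScalarsHom K : Gal(L/E) → Gal(L/K)`, identity on `Lˣ`);
  **`map_unitsAbsInfTwo_eq_unitsAbsInfTwo_unitsRes`**: `H²(res, ι) (inf_{L/K} x) = inf_{L/E} (Res x)` in
  `H²(Γ_E, Ēˣ)` — the two `K`-embeddings `L → Ē` (`Ē ← K̄ ← L` and `ι_{L/E}`) differ by an element of `Gal(L/K)`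
  (`L/K` normal), so the two compatible pairs give the same class.
* §3 **`layerInv_unitsRes`**: `inv_{L/E}(Res x) = [E:K] · inv_{L/K}(x)`; **`unitsRes_fundamentalClass`**:
  `Res u_{L/K} = u_{L/E}` (Serre XI §3 "`Res(u_{F/E}) = u_{F/E'}`"; Neukirch II (1.6) b)); `zmodToQmodZ_mul_left`.

HONEST FRAMING: classical local class field theory; no case of BSD or of Poitou–Tate is proved.  Route A use
(bsd-schneider cell, crux `AnticycControlAdditiveK`): the restriction axiom of the LOCAL class formation with THE
canonical classes, and the local input of `inv_w(res c) = [E_w:F_v]_{rel} · inv_v(c)` on idèle classes.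

## References
* J.-P. Serre, *Local Fields*, GTM 67 (1979), Ch. XIII §3 Prop. 7; Ch. XI §3 (formulas for `u_{F/E}`).
  [SerreLocalFields1979]
* J. Neukirch, *Class Field Theory — The Bonn Lectures* (2013), Part II §1 Prop. (1.6) b). [Neukirch2013]
-/

noncomputable section

open CategoryTheory groupCohomology Function Field

namespace Literature.NumberTheory.GaloisRepresentations

namespace UnitsLayer

open DiscreteGaloisModule Literature.Algebra.Homology Literature.NumberTheory.GaloisCohomology
open Literature.AnabelianGeometry.AbsoluteAnabelian.Prop121vii

attribute [local instance] absoluteGaloisGroup_compactSpace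

/-! ## §1. `inv_E ∘ Res = [E:K] · inv_K` on `H²(·, ·̄ˣ)` -/

section Brauer

variable (K E : Type) [Field K] [ValuativeRel K] [TopologicalSpace K] [IsNonarchimedeanLocalField K] [CharZero K]
  [Field E] [ValuativeRel E] [TopologicalSpace E] [IsNonarchimedeanLocalField E] [CharZero E]
  [Algebra K E] [FiniteDimensional K E]

/-- **`inv_E (Res_{E/K} z) = [E:K] · inv_K (z)`** for every Brauer class `z ∈ H²(Γ_K, K̄ˣ)`, the restriction being
`H²(res, ι)` for any standard units morphism `ι : K̄ˣ → Ēˣ` (`u ↦ ι(u)`, `exists_unitsHom`): Kummer preimage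
(`exists_cohomologyMap_kummerι_eq`), `cohomologyMap_kummerι_resMu`, `invLevel_resMu`, `brauerInvariantEquiv_kummer`.
[cite: SerreLocalFields1979, Ch. XIII §3 Prop. 7] -/
theorem brauerInvariantEquiv_map_res
    (φ : TopRep.res ((absGaloisRestrict K E : absoluteGaloisGroup E →ₜ* absoluteGaloisGroup K) :
        absoluteGaloisGroup E →* absoluteGaloisGroup K) (units K).toTopRep ⟶ (units E).toTopRep)
    (hφ : ∀ u : (AlgebraicClosure K)ˣ, φ.hom (UnitsCarrier.ofUnits u) =
      UnitsCarrier.ofUnits (Units.map (absClosureEmbedding K E : AlgebraicClosure K →* AlgebraicClosure E) u))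
    (z : galoisCohomology (units K) 2) :
    brauerInvariantEquiv E ((ContinuousCohomology.map (absGaloisRestrict K E) φ 2).hom z) =
      Module.finrank K E • brauerInvariantEquiv K z := by
  obtain ⟨n, x, rfl⟩ := exists_cohomologyMap_kummerι_eq z
  have h := cohomologyMap_kummerι_resMu K E (n : ℕ) φ hφ 2 x
  change (cohomologyMap (kummerι E (n : ℕ)) 2) (resMu K E (n : ℕ) 2 x) =
    (ContinuousCohomology.map (absGaloisRestrict K E) φ 2).hom (cohomologyMap (kummerι K (n : ℕ)) 2 x) at h
  rw [← h, brauerInvariantEquiv_kummer, brauerInvariantEquiv_kummer, invLevel_resMu, ← nsmul_eq_mul,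
    ← zmodToQmodZ_apply, ← zmodToQmodZ_apply, map_nsmul]

end Brauer

/-! ## §2. The units layer under restriction to an intermediate base; the dictionary square -/

section Layer

variable (K : Type) [Field K] [CharZero K] (E : Type) [Field E] [CharZero E] [Algebra K E]
variable (L : Type) [Field L] [Algebra K L] [Algebra E L] [IsScalarTower K E L] [FiniteDimensional K L] [IsGalois K L]

omit [CharZero K] [CharZero E] [FiniteDimensional K L] [IsGalois K L] in
/-- **The identity `Lˣ → Lˣ` as a morphism `Res_{Gal(L/E) ↪ Gal(L/K)} (Lˣ) ⟶ Lˣ`** of `Gal(L/E)`-modules (an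
`E`-automorphism acts on `Lˣ` as its restriction of scalars to `K`).
[cite: SerreLocalFields1979, Ch. XI §3][cite: Neukirch2013, Part II §1 Prop. (1.6) b)] -/
def unitsResHom :
    Rep.res (AlgEquiv.restrictScalarsHom K : (L ≃ₐ[E] L) →* (L ≃ₐ[K] L)) (Rep.ofAlgebraAutOnUnits K L) ⟶
      Rep.ofAlgebraAutOnUnits E L :=
  Rep.ofHom ⟨LinearMap.id, fun _ => LinearMap.ext fun _ => rfl⟩

omit [CharZero K] [CharZero E] [FiniteDimensional K L] [IsGalois K L] in
/-- Unfolding: `unitsResHom` is the identity on elements. [cite: SerreLocalFields1979, Ch. XI §3] -/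
@[simp] theorem unitsResHom_hom_apply (x : (Rep.ofAlgebraAutOnUnits K L).V) : (unitsResHom K E L).hom x = x := rfl

omit [CharZero K] [CharZero E] [FiniteDimensional K L] [IsGalois K L] in
/-- **`Res : Hⁿ(Gal(L/K), Lˣ) ⟶ Hⁿ(Gal(L/E), Lˣ)`** (Mathlib `groupCohomology.map` along `restrictScalarsHom K`).
[cite: SerreLocalFields1979, Ch. XI §3][cite: Neukirch2013, Part II §1 Prop. (1.6) b)] -/
def unitsRes (n : ℕ) :
    groupCohomology (Rep.ofAlgebraAutOnUnits K L) n ⟶ groupCohomology (Rep.ofAlgebraAutOnUnits E L) n :=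
  groupCohomology.map (AlgEquiv.restrictScalarsHom K) (unitsResHom K E L) n

omit [CharZero K] [CharZero E] in
/-- **The two `K`-embeddings `L → Ē`** — through `K̄` (`ι ∘ ι_{L/K}`) and directly (`ι_{L/E}`) — **differ by an
element of `Gal(L/K)`** (`L/K` is normal; Mathlib `AlgHom.restrictNormal'`).
[cite: SerreLocalFields1979, Ch. VII §5 Prop. 3] -/
theorem exists_algEquiv_embeddingToAbs_eq :
    ∃ σ : L ≃ₐ[K] L, ∀ x : L,
      (haveI : FiniteDimensional E L := Module.Finite.of_restrictScalars_finite K E L; embeddingToAbs E L x) =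
        absClosureEmbedding K E (embeddingToAbs K L (σ x)) := by
  haveI : FiniteDimensional E L := Module.Finite.of_restrictScalars_finite K E L
  let j₁ : L →ₐ[K] AlgebraicClosure E := (absClosureEmbedding K E).comp (embeddingToAbs K L)
  let j₂ : L →ₐ[K] AlgebraicClosure E := (embeddingToAbs E L).restrictScalars K
  letI : Algebra L (AlgebraicClosure E) := (j₁ : L →+* _).toAlgebra
  haveI : IsScalarTower K L (AlgebraicClosure E) := IsScalarTower.of_algebraMap_eq fun a => (j₁.commutes a).symm
  refine ⟨j₂.restrictNormal' L, fun x => ?_⟩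
  have h := AlgHom.restrictNormal_commutes j₂ L x
  rw [Algebra.algebraMap_self, RingHom.id_apply] at h
  exact h.symm

/-- **The dictionary square `Res_{E/K} ∘ inf_{L/K} = inf_{L/E} ∘ Res` in `H²(Γ_E, Ēˣ)`**: for every standard units
morphism `ι : K̄ˣ → Ēˣ` over `res : Γ_E → Γ_K`,
`H²(res, ι) (unitsAbsInfTwo K L x) = unitsAbsInfTwo E L (unitsRes K E L 2 x)` — both are pulls of the same
cocycle along compatible pairs attached to the two `K`-embeddings `L → Ē`, which are `Gal(L/K)`-conjugate.
[cite: SerreGaloisCohomology1997, Ch. I §2.4][cite: SerreLocalFields1979, Ch. VII §5 Prop. 3] -/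
theorem map_unitsAbsInfTwo_eq_unitsAbsInfTwo_unitsRes
    (φ : TopRep.res ((absGaloisRestrict K E : absoluteGaloisGroup E →ₜ* absoluteGaloisGroup K) :
        absoluteGaloisGroup E →* absoluteGaloisGroup K) (units K).toTopRep ⟶ (units E).toTopRep)
    (hφ : ∀ u : (AlgebraicClosure K)ˣ, φ.hom (UnitsCarrier.ofUnits u) =
      UnitsCarrier.ofUnits (Units.map (absClosureEmbedding K E : AlgebraicClosure K →* AlgebraicClosure E) u))
    (x : groupCohomology (Rep.ofAlgebraAutOnUnits K L) 2) :
    (ContinuousCohomology.map (absGaloisRestrict K E) φ 2).hom (unitsAbsInfTwo K L x) =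
      (haveI : FiniteDimensional E L := Module.Finite.of_restrictScalars_finite K E L
       haveI : IsGalois E L := IsGalois.tower_top_of_isGalois K E L
       unitsAbsInfTwo E L (unitsRes K E L 2 x)) := by
  haveI : FiniteDimensional E L := Module.Finite.of_restrictScalars_finite K E L
  haveI : IsGalois E L := IsGalois.tower_top_of_isGalois K E L
  induction x using H2_induction_on with
  | h b =>
  rw [map_unitsAbsInfTwo_H2π]
  change _ = unitsAbsInfTwo E L
    (groupCohomology.map (AlgEquiv.restrictScalarsHom K) (unitsResHom K E L) 2 (H2π _ b))
  rw [H2π_comp_map_apply, unitsAbsInfTwo_H2π, CompatiblePair.pull_mapCocycles₂]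
  obtain ⟨σ, hσ⟩ := exists_algEquiv_embeddingToAbs_eq K E L
  exact (CompatiblePair.twoCocycleClass_pull_eq_of_ringHom_eq_comp E
    ((absUnitsPair K L).pullback (absGaloisRestrict K E) φ)
    ((absUnitsPair E L).compMap (AlgEquiv.restrictScalarsHom K) (unitsResHom K E L))
    (((absClosureEmbedding K E : AlgebraicClosure K →+* AlgebraicClosure E).comp
      (embeddingToAbs K L : L →+* AlgebraicClosure K)))
    (embeddingToAbs E L : L →+* AlgebraicClosure E) σ
    (pullback_absUnitsPair_φ_ofMul K L E φ hφ) (fun u => absUnitsPair_φ_ofMul E L u) hσ b).symm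

end Layer

/-! ## §3. `inv_{L/E} ∘ Res = [E:K] · inv_{L/K}` and `Res u_{L/K} = u_{L/E}` -/

section LocalLayer

variable (K E : Type) [Field K] [ValuativeRel K] [TopologicalSpace K] [IsNonarchimedeanLocalField K] [CharZero K]
  [Field E] [ValuativeRel E] [TopologicalSpace E] [IsNonarchimedeanLocalField E] [CharZero E]
  [Algebra K E] [FiniteDimensional K E]
variable (L : Type) [Field L] [Algebra K L] [Algebra E L] [IsScalarTower K E L] [FiniteDimensional K L] [IsGalois K L]

/-- **`inv_{L/E}(Res x) = [E:K] · inv_{L/K}(x)`** for door-c6's canonical invariant maps of the abstract layers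
`L/K` and `L/E` (Serre XIII §3 Prop. 7 transported through the dictionary square).
[cite: SerreLocalFields1979, Ch. XIII §3 Prop. 7][cite: Neukirch2013, Part II §1 Prop. (1.6) b)] -/
theorem layerInv_unitsRes (x : groupCohomology (Rep.ofAlgebraAutOnUnits K L) 2) :
    (haveI : FiniteDimensional E L := Module.Finite.of_restrictScalars_finite K E L
     haveI : IsGalois E L := IsGalois.tower_top_of_isGalois K E L
     layerInv E L (unitsRes K E L 2 x)) = Module.finrank K E • layerInv K L x := by
  haveI : FiniteDimensional E L := Module.Finite.of_restrictScalars_finite K E L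
  haveI : IsGalois E L := IsGalois.tower_top_of_isGalois K E L
  obtain ⟨φ, hφ⟩ := exists_unitsHom (F := K) E
  rw [layerInv_eq_brauerInvariantEquiv_unitsAbsInfTwo, layerInv_eq_brauerInvariantEquiv_unitsAbsInfTwo,
    ← map_unitsAbsInfTwo_eq_unitsAbsInfTwo_unitsRes K E L φ hφ x, brauerInvariantEquiv_map_res K E φ hφ]

/-- **`Res u_{L/K} = u_{L/E}`**: the restriction of the canonical fundamental class of `L/K` to `Gal(L/E)` is the
canonical fundamental class of `L/E` (`[E:K] · (1/[L:K]) = 1/[L:E]`).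
[cite: SerreLocalFields1979, Ch. XI §3][cite: Neukirch2013, Part II §1 Prop. (1.6) b)] -/
theorem unitsRes_fundamentalClass :
    unitsRes K E L 2 (fundamentalClass K L) =
      (haveI : FiniteDimensional E L := Module.Finite.of_restrictScalars_finite K E L
       haveI : IsGalois E L := IsGalois.tower_top_of_isGalois K E L
       fundamentalClass E L) := by
  haveI : FiniteDimensional E L := Module.Finite.of_restrictScalars_finite K E L
  haveI : IsGalois E L := IsGalois.tower_top_of_isGalois K E L
  refine eq_fundamentalClass_of_layerInv_eq E L ?_
  rw [layerInv_unitsRes, layerInv_fundamentalClass, ← AddCircle.coe_nsmul, nsmul_eq_mul,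
    ← Module.finrank_mul_finrank K E L, Nat.cast_mul]
  congr 1
  have hE : (Module.finrank K E : ℚ) ≠ 0 := Nat.cast_ne_zero.2 Module.finrank_pos.ne'
  have hL : (Module.finrank E L : ℚ) ≠ 0 := Nat.cast_ne_zero.2 Module.finrank_pos.ne'
  field_simp

end LocalLayer

end UnitsLayer

end Literature.NumberTheory.GaloisRepresentations

end
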